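import Summits.BirchSwinnertonDyer.BirchSwinnertonDyer.Theorems.QuadraticBranchSignedControlPlusEtaNonsurjConjADoor
import Summits.BirchSwinnertonDyer.BirchSwinnertonDyer.Theorems.QuadraticBranchSignedControlPlusEtaNonsurjFineRoadConjA
import Literature.NumberTheory.EllipticCurves.FineSelmerIsotypicClassGroupCriterion
import HarnessLib

/-!
# Route `QuadraticBranchSignedControl` (rung K8, cell `bsd-potss`), residual crux `PlusEtaMainConjectureNonsurj`
# (stmt-BirchSwinnertonDyer-19606): DOOR L2 — statement (A) and (C1⁺_η) on the partner / row of crux 19606 from the PLAIN tautological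
# EIGEN-TEST on `Cl(ℚ(P))` (seat `bsd-potss-k8eta-c2` g21; the K8 wrapper of conjA-anchor g17's `CoatesSujatha2005.conjA_of_eigenHom_subfield`)

WHY. The k8eta-c2 g21 census at `p = 5` (kit j326603, table `E5-CLASSIFICATION-k8eta-c2-g21.tsv`) finds 10 K8 partner rows `W` with `5 ∣ h(ℚ(P))`,
door L6⁻ void, but NO tautological class: the involution-free eigen datum «`2` is not an eigenvalue of `σ₂` on `Cl(ℚ(P)) ⊗ 𝔽₅`» (`d₂ = 0`; the
`5`-part of the class group sits in the `σ₂ = 3` eigenspace, `d₃ = 1`) — 176400ld1, 416025bc1, 313200ek1 (non-CM), 112225a1, 114075bh1, 297675cj1,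
119025e1, 313200el1 (non-CM), 456300ee1 and the ninth anchor 10800cj1. conjA-anchor g17's FACT-FREE eigen door
`CoatesSujatha2005.conjA_of_eigenHom_subfield` turns exactly this datum into statement (A): `W[p]` irreducible, (c1), a subfield `K ⊆ ℚ(W[p])` whose
absolute Galois group fixes `P ≠ 0`, «every additive `μ : Cl(𝓞_K) → ℤ/p` with `μ[σ̄I] = a•μ[I]` whenever `τ|_K = σ̄`, `τ•P = a•P` vanishes»,
(c3) ⟹ (A). p690512 used it only at `p ∤ h(K)` and p702974 only at `a = p − 1` (door L6⁻); the cell had no K8 wrapper displaying the eigen datum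
itself. This file supplies it ((c1), (c3), irreducibility discharged by p690512 — no `hVH` is needed for the plain eigen-test) and composes it with
k8eta-c2 g6's fine road BY NAME, as p691623 / p703312 / p706955 did for the other doors.

WHAT. §1 `smul_eq_self_of_fixes_stabilizerField` (a `τ` fixing the stabiliser field `ℚ(P)` pointwise fixes `P`), `conjA_partner_of_eigenHom`,
`conjA_row_of_eigenHom` (fact-free). §2 `etaUpperIntegral_of_eigenHom_of_analyticMu` (integral Kato inclusion at `η`; `h22 h41 h6273` + `μ_an = 0`),
`quadraticBranchPlusEtaMainConjectureAt_of_eigenHom_of_span_eq_span_X` (prime-`L` rank-1 shape: 112225a1, 297675cj1, 313200el1 (non-CM),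
456300ee1 at `p = 5`), `…_of_eigenHom_of_analyticMu_of_missingLowerBoundAt` (rank 0), `…_of_eigenHom_of_analyticMu_of_hasCM_rankZero` (CM rank 0).

HONEST FRAMING (cell `bsd-potss`; FULL-BSD rank ≤ 1 programme, HUMAN RULING D-0036/D-0074): TOOL THEOREMS / COMPOSITIONS ONLY — no definition,
no named fact minted, no `sorry`, axioms standard; §2 CONDITIONAL on the displayed named facts; the eigen datum stays displayed (GRH class-group
computations are evidence, never facts). No stub of 19606 is proved by name; the crux stays OPEN; nothing is booked; (A) and `BSD(W,p)` are
claimed for no pair. `--supports stmt-BirchSwinnertonDyer-19606 --as helper`.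

References: [CoatesSujatha2005] §3 Conjecture A, Thm. 3.4, Lemma 3.8; [DeoRaySujatha2023] Thm. 3.8 (c1)–(c3) (arXiv:2202.09937 p. 9);
[Serre1972] §1.11 Prop. 12, §2.4 Prop. 15; [SilvermanAEC2009] X.5 Cor. 5.4; [Kobayashi2003] Thm. 2.2, §4 + Thm. 4.1, Thm. 6.2/6.3/7.3 i);
[GreenbergLNM1716] §4 Lemma 4.2; [KitajimaOtsuki2018] Thm. 1.3; [Miller2011LMS] Def. 1.1; [BurungaleFlach2024] Thm. 1.1.
-/

set_option autoImplicit false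
set_option linter.dupNamespace false
noncomputable section

open scoped Classical nonZeroDivisors

open NumberField IsDedekindDomain Field WeierstrassCurve
open Literature.NumberTheory.EllipticCurves Literature.NumberTheory.GaloisRepresentations
  Literature.NumberTheory.EllipticCurves.Rank1Residual Literature.NumberTheory.NumberFields Rat.HeightOneSpectrum
open Literature.NumberTheory.EllipticCurves.GreenbergSelmer (decomp)
open Literature.NumberTheory.EllipticCurves.CoatesSujatha2005
open Summit.BirchSwinnertonDyer.Rank1Residual Summit.BirchSwinnertonDyer.Rank1Residual.GaloisImage
open Summit.BirchSwinnertonDyer.BirchSwinnertonDyer.Theorems.EtaConjADoor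

namespace Summit.BirchSwinnertonDyer.BirchSwinnertonDyer.Theorems.EtaConjADoorEigen

variable (p : ℕ) [hp : Fact p.Prime]

/-! ## §1 The eigen door on the partner and on the row, fact-free -/

omit hp in
/-- **`Γ_{ℚ(P)}` fixes `P`.** For `K` the fixed field of the image of `Stab(P)` in `Gal(ℚ(E[p])/ℚ)`, every `τ ∈ Γ_ℚ` whose restriction fixes
`K` pointwise fixes `P` (Galois correspondence for the finite Galois extension `ℚ(E[p])/ℚ` + faithfulness of `Gal(ℚ(E[p])/ℚ)` on `E[p]`).
[cite: NeukirchANT1999, Ch. IV §1 (Galois correspondence)] -/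
theorem smul_eq_self_of_fixes_stabilizerField {E : WeierstrassCurve ℚ} [E.IsElliptic] [NeZero p]
    [NumberField (E.divisionField p)] (P : geomTorsion E (p : ℤ)) (K : IntermediateField ℚ (E.divisionField p))
    (hK : K = IntermediateField.fixedField
      ((MulAction.stabilizer (absoluteGaloisGroup ℚ) P).map (absRestrictNormalHom (E.divisionField p))))
    (τ : absoluteGaloisGroup ℚ) (hτ : ∀ x : K, absRestrictNormalHom (E.divisionField p) τ (x : E.divisionField p) = x) :
    τ • P = P := by
  have hmem : absRestrictNormalHom (E.divisionField p) τ ∈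
      (MulAction.stabilizer (absoluteGaloisGroup ℚ) P).map (absRestrictNormalHom (E.divisionField p)) := by
    rw [← IntermediateField.fixingSubgroup_fixedField
      ((MulAction.stabilizer (absoluteGaloisGroup ℚ) P).map (absRestrictNormalHom (E.divisionField p))),
      IntermediateField.mem_fixingSubgroup_iff]
    intro x hx
    exact hτ ⟨x, hK ▸ hx⟩
  obtain ⟨τ₀, hτ₀, hres⟩ := Subgroup.mem_map.mp hmem
  have h1 : absRestrictNormalHom (E.divisionField p) (τ₀⁻¹ * τ) = 1 := by
    rw [map_mul, map_inv, hres, inv_mul_cancel]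
  have h2 := (E.absRestrictNormalHom_divisionField_eq_one_iff p (τ₀⁻¹ * τ)).mp h1 P
  rw [mul_smul, inv_smul_eq_iff] at h2
  rw [h2]; exact hτ₀

section K8

variable (V : WeierstrassCurve ℚ) [V.IsElliptic] [V.IsGloballyMinimal] (W : WeierstrassCurve ℚ) (C : VariableChange ℚ)

/-- **(A) on the PARTNER `W` of a row of crux 19606 from the plain tautological eigen-test** (`C • W^{(p*)} = V`, `V` globally minimal,
`p ≥ 5` good, `a_p(V) = 0`, tower not onto): for one `P ∈ W[p] ∖ 0` with `K = ℚ(P)` the stabiliser field, if every additive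
`μ : Cl(𝓞_K) → ℤ/p` satisfying the tautological relations `μ[σ̄I] = a • μ[I]` (`τ|_K = σ̄`, `τ • P = a • P`) vanishes — numerically (door L2):
«`2` is not an eigenvalue of `σ₂` on `Cl(𝓞_K) ⊗ 𝔽_p`» — then statement (A) holds for `(W, p)`. conjA-anchor g17's `conjA_of_eigenHom_subfield`;
(c1), (c3), irreducibility by p690512. NO named fact. [cite: CoatesSujatha2005, §3 Thm. 3.4 and Lemma 3.8]
[cite: DeoRaySujatha2023, §3 Thm. 3.8 (c1)–(c3) (arXiv:2202.09937 p. 9)] [cite: SilvermanAEC2009, X.5 Cor. 5.4] -/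
theorem conjA_partner_of_eigenHom [W.IsElliptic] [NeZero p] (hp5 : 5 ≤ p)
    (hC : C • W.quadraticTwist ((-1) ^ (p / 2) * p) = V)
    (hgood : V.HasGoodReductionAtPrime p) (hap : V.frobeniusTrace p = 0)
    (hns : ¬ ∀ m : ℕ, V.HasSurjectiveModNGaloisRep (p ^ m : ℕ))
    (hP : haveI : NumberField (W.divisionField p) := NumberField.mk
      ∃ P : geomTorsion W (p : ℤ), P ≠ 0 ∧
        ∀ K : IntermediateField ℚ (W.divisionField p),
          K = IntermediateField.fixedField
            ((MulAction.stabilizer (absoluteGaloisGroup ℚ) P).map (absRestrictNormalHom (W.divisionField p))) →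
        ∀ μ : Additive (ClassGroup (𝓞 K)) →+ ZMod p,
          (∀ (τ : absoluteGaloisGroup ℚ) (σ : K ≃ₐ[ℚ] K) (a : ℕ),
              (∀ x : K, absRestrictNormalHom (W.divisionField p) τ (x : W.divisionField p) =
                ((σ x : K) : W.divisionField p)) → τ • P = a • P →
              ∀ (I J : (Ideal (𝓞 K))⁰),
                (J : Ideal (𝓞 K)) = (I : Ideal (𝓞 K)).map (AmbiguousClass.intAut σ : 𝓞 K →+* 𝓞 K) →
                μ (Additive.ofMul (ClassGroup.mk0 J)) = a • μ (Additive.ofMul (ClassGroup.mk0 I))) →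
          μ = 0)
    (κ : ZpExtension ℚ p) (hκ : κ.IsCyclotomic) :
    ∃ (γ : absoluteGaloisGroup ℚ) (D : W.FineSelmerDualData κ γ),
      Module.Finite ℤ_[p] (RestrictScalars ℤ_[p] (IwasawaAlgebra p) D.X) := by
  haveI : NumberField (W.divisionField p) := NumberField.mk
  obtain ⟨P, hP0, h⟩ := hP
  set K : IntermediateField ℚ (W.divisionField p) := IntermediateField.fixedField
    ((MulAction.stabilizer (absoluteGaloisGroup ℚ) P).map (absRestrictNormalHom (W.divisionField p))) with hKdef
  exact conjA_of_eigenHom_subfield W (by omega) (irreducible_partner V p W C hp5 hgood hap hC)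
    (not_dvd_card_aut_divisionField_partner V p W C hp5 hgood hap hns hC) K P hP0
    (smul_eq_self_of_fixes_stabilizerField p P K hKdef) (h K hKdef) hκ
    (fun v hv x hpx hx => geomPrimaryTorsion_fixed_eq_zero_partner V p W C hp5 hgood hap hC v hv x hpx hx)

/-- **(A) on a ROW `V` of crux 19606 from the plain tautological eigen-test** (`V` globally minimal, `p ≥ 5` good, `a_p = 0`, tower not
onto; `K = ℚ(P)` for one `P ∈ V[p] ∖ 0`): g17's eigen door with (c1), (c3), irreducibility from p690512. NO named fact.
[cite: CoatesSujatha2005, §3 Thm. 3.4 and Lemma 3.8] [cite: DeoRaySujatha2023, §3 Thm. 3.8 (c1)–(c3) (arXiv:2202.09937 p. 9)]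
[cite: Serre1972, §1.11 Prop. 12 and §2.4 Prop. 15] -/
theorem conjA_row_of_eigenHom [NeZero p] (hp5 : 5 ≤ p)
    (hgood : V.HasGoodReductionAtPrime p) (hap : V.frobeniusTrace p = 0)
    (hns : ¬ ∀ m : ℕ, V.HasSurjectiveModNGaloisRep (p ^ m : ℕ))
    (hP : haveI : NumberField (V.divisionField p) := NumberField.mk
      ∃ P : geomTorsion V (p : ℤ), P ≠ 0 ∧
        ∀ K : IntermediateField ℚ (V.divisionField p),
          K = IntermediateField.fixedField
            ((MulAction.stabilizer (absoluteGaloisGroup ℚ) P).map (absRestrictNormalHom (V.divisionField p))) →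
        ∀ μ : Additive (ClassGroup (𝓞 K)) →+ ZMod p,
          (∀ (τ : absoluteGaloisGroup ℚ) (σ : K ≃ₐ[ℚ] K) (a : ℕ),
              (∀ x : K, absRestrictNormalHom (V.divisionField p) τ (x : V.divisionField p) =
                ((σ x : K) : V.divisionField p)) → τ • P = a • P →
              ∀ (I J : (Ideal (𝓞 K))⁰),
                (J : Ideal (𝓞 K)) = (I : Ideal (𝓞 K)).map (AmbiguousClass.intAut σ : 𝓞 K →+* 𝓞 K) →
                μ (Additive.ofMul (ClassGroup.mk0 J)) = a • μ (Additive.ofMul (ClassGroup.mk0 I))) →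
          μ = 0)
    (κ : ZpExtension ℚ p) (hκ : κ.IsCyclotomic) :
    ∃ (γ : absoluteGaloisGroup ℚ) (D : V.FineSelmerDualData κ γ),
      Module.Finite ℤ_[p] (RestrictScalars ℤ_[p] (IwasawaAlgebra p) D.X) := by
  haveI : NumberField (V.divisionField p) := NumberField.mk
  obtain ⟨P, hP0, h⟩ := hP
  set K : IntermediateField ℚ (V.divisionField p) := IntermediateField.fixedField
    ((MulAction.stabilizer (absoluteGaloisGroup ℚ) P).map (absRestrictNormalHom (V.divisionField p))) with hKdef
  exact conjA_of_eigenHom_subfield V (by omega) (irreducible_of_row V p hp5 hgood hap)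
    (not_dvd_card_aut_divisionField_of_row V p hp5 hgood hap hns) K P hP0
    (smul_eq_self_of_fixes_stabilizerField p P K hKdef) (h K hKdef) hκ
    (fun v hv x hpx hx => geomPrimaryTorsion_fixed_eq_zero_of_row V p hp5 hgood hap v hv x hpx hx)

end K8

/-! ## §2 Door L2 ∘ the fine road BY NAME (as p691623 / p703312 / p706955) -/

section Upper

open CongruenceSubgroup Literature.NumberTheory.EllipticCurves.ModularForms
  Literature.NumberTheory.EllipticCurves.Rank1Residual.Typed Literature.NumberTheory.GaloisCohomology
  Literature.NumberTheory.EllipticCurves.GreenbergVatsal2000 ZpExtension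
open Summit.BirchSwinnertonDyer.Rank1Residual.Additive

variable (V : WeierstrassCurve ℚ) [V.IsElliptic] [V.IsGloballyMinimal] (W : WeierstrassCurve ℚ) [W.IsElliptic]
  [W.IsGloballyMinimal] (C : VariableChange ℚ)

omit [W.IsGloballyMinimal] in
/-- **The INTEGRAL Kato-side inclusion at `η` on a row from the eigen datum and the analytic `μ`** — door L2 (`conjA_partner_of_eigenHom`) fed
to k8eta-c2 g6's `EtaFineRoad.etaUpperIntegral_of_conjA_of_analyticMu`. Named facts `h22 h41 h6273`; displayed: the eigen datum, `μ_an = 0`.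
CONDITIONAL; nothing booked. [cite: Kobayashi2003, Thm. 4.1 first display (p. 8), Thm. 2.2 (p. 5), Thm. 7.3 i) (7.21) (p. 13)]
[cite: CoatesSujatha2005, §3 (A) and Thm. 3.4] -/
theorem etaUpperIntegral_of_eigenHom_of_analyticMu
    (h22 : Kobayashi2003.thm22_etaSignedSelmerDual_finite_torsion)
    (h41 : Kobayashi2003.thm41_plusEtaCharIdeal_dvd)
    (h6273 : Kobayashi2003.thm62_63_73_etaColemanPoitouTate)
    [NeZero p] (hp5 : 5 ≤ p) (hC : C • W.quadraticTwist ((-1) ^ (p / 2) * p) = V)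
    (hgood : V.HasGoodReductionAtPrime p) (hap : V.frobeniusTrace p = 0)
    (hns : ¬ ∀ m : ℕ, V.HasSurjectiveModNGaloisRep (p ^ m : ℕ))
    (hP : haveI : NumberField (W.divisionField p) := NumberField.mk
      ∃ P : geomTorsion W (p : ℤ), P ≠ 0 ∧
        ∀ K : IntermediateField ℚ (W.divisionField p),
          K = IntermediateField.fixedField
            ((MulAction.stabilizer (absoluteGaloisGroup ℚ) P).map (absRestrictNormalHom (W.divisionField p))) →
        ∀ μ : Additive (ClassGroup (𝓞 K)) →+ ZMod p,
          (∀ (τ : absoluteGaloisGroup ℚ) (σ : K ≃ₐ[ℚ] K) (a : ℕ),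
              (∀ x : K, absRestrictNormalHom (W.divisionField p) τ (x : W.divisionField p) =
                ((σ x : K) : W.divisionField p)) → τ • P = a • P →
              ∀ (I J : (Ideal (𝓞 K))⁰),
                (J : Ideal (𝓞 K)) = (I : Ideal (𝓞 K)).map (AmbiguousClass.intAut σ : 𝓞 K →+* 𝓞 K) →
                μ (Additive.ofMul (ClassGroup.mk0 J)) = a • μ (Additive.ofMul (ClassGroup.mk0 I))) →
          μ = 0)
    (hμan : ∀ {N : ℕ} [NeZero N] {f : CuspForm (Gamma0 N) 2}, IsNewformOf V f →
      ∀ (ϖ : ℚ), (if Even (p / 2) then (ϖ : ℝ) * V.realPeriodRat = plusPeriod f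
          else (ϖ : ℝ) * V.imaginaryPeriodRat = minusPeriod f) →
      ∀ (Lη : IwasawaAlgebra p), IsQuadraticBranchPlusLFunction f p ϖ Lη → HasUnitContent Lη) :
    ∀ (K₀ : Type) [Field K₀] [NumberField K₀] [IsCyclotomicExtension {p} ℚ K₀]
        [(galRange (K := ℚ) K₀).Normal] (ηq : absoluteGaloisGroup ℚ →* ℤˣ),
        (∀ σ ∈ galRange (K := ℚ) K₀, ηq σ = 1) → ηq ≠ 1 →
      ∀ {N : ℕ} [NeZero N] {f : CuspForm (Gamma0 N) 2},
        p ≠ 2 → V.HasGoodReductionAtPrime p → V.frobeniusTrace p = 0 → IsNewformOf V f →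
      ∀ (ϖ : ℚ), (if Even (p / 2) then (ϖ : ℝ) * V.realPeriodRat = plusPeriod f
          else (ϖ : ℝ) * V.imaginaryPeriodRat = minusPeriod f) →
      ∀ (Lη : IwasawaAlgebra p), IsQuadraticBranchPlusLFunction f p ϖ Lη →
      ∀ (κ : ZpExtension ℚ p) (γ : absoluteGaloisGroup ℚ),
        κ.IsCyclotomic → κ.IsTopGenerator γ → γ ∈ galRange (K := ℚ) K₀ → IsCyclotomicVariable p γ →
      ∀ (D : EtaSignedSelmerDualData V κ K₀ ℚ_[p] ηq γ 1), Ideal.span {Lη} ≤ D.charIdeal :=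
  EtaFineRoad.etaUpperIntegral_of_conjA_of_analyticMu W p h22 h41 h6273 V C hC
    (conjA_partner_of_eigenHom p V W C hp5 hC hgood hap hns hP) hμan

omit [W.IsGloballyMinimal] in
/-- **Prime-`L` rank-`1` shape: (C1⁺_η)(V) from the eigen datum ALONE** (granted `h22 h41 h6273`): `Sel_{p^∞}(W/ℚ)` infinite and
`(L_p⁺(V,η,X)) = (X)` + the datum ⟹ `QuadraticBranchPlusEtaMainConjectureAt V p` — door L2 fed to
`EtaFineRoad.quadraticBranchPlusEtaMainConjectureAt_of_span_eq_span_X_of_conjA` (census k8eta-c2 g21: the L2 rows 112225a1, 297675cj1, 313200el1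
(non-CM), 456300ee1 have `r_an(W) = 1`, `λ⁺ = 1` at `p = 5`). CONDITIONAL; nothing booked.
[cite: Kobayashi2003, §4 Even main conjecture and Thm. 4.1 first display (p. 8), Thm. 7.3 i) (p. 13)] [cite: CoatesSujatha2005, §3 statement (A)]
[cite: GreenbergLNM1716, §4 Lemma 4.2 (p. 102)] -/
theorem quadraticBranchPlusEtaMainConjectureAt_of_eigenHom_of_span_eq_span_X
    (h22 : Kobayashi2003.thm22_etaSignedSelmerDual_finite_torsion)
    (h41 : Kobayashi2003.thm41_plusEtaCharIdeal_dvd)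
    (h6273 : Kobayashi2003.thm62_63_73_etaColemanPoitouTate)
    [NeZero p] (hp5 : 5 ≤ p) (hC : C • W.quadraticTwist ((-1) ^ (p / 2) * p) = V)
    (hgood : V.HasGoodReductionAtPrime p) (hap : V.frobeniusTrace p = 0)
    (hns : ¬ ∀ m : ℕ, V.HasSurjectiveModNGaloisRep (p ^ m : ℕ))
    (hinf : ¬ Finite ↥(W.selmerGroupPInfty p))
    (hX : ∀ {N : ℕ} [NeZero N] {f : CuspForm (Gamma0 N) 2}, IsNewformOf V f →
      ∀ (ϖ : ℚ), (if Even (p / 2) then (ϖ : ℝ) * V.realPeriodRat = plusPeriod f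
          else (ϖ : ℝ) * V.imaginaryPeriodRat = minusPeriod f) →
      ∀ (Lη : IwasawaAlgebra p), IsQuadraticBranchPlusLFunction f p ϖ Lη →
        Ideal.span {Lη} = Ideal.span {(PowerSeries.X : IwasawaAlgebra p)})
    (hP : haveI : NumberField (W.divisionField p) := NumberField.mk
      ∃ P : geomTorsion W (p : ℤ), P ≠ 0 ∧
        ∀ K : IntermediateField ℚ (W.divisionField p),
          K = IntermediateField.fixedField
            ((MulAction.stabilizer (absoluteGaloisGroup ℚ) P).map (absRestrictNormalHom (W.divisionField p))) →
        ∀ μ : Additive (ClassGroup (𝓞 K)) →+ ZMod p,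
          (∀ (τ : absoluteGaloisGroup ℚ) (σ : K ≃ₐ[ℚ] K) (a : ℕ),
              (∀ x : K, absRestrictNormalHom (W.divisionField p) τ (x : W.divisionField p) =
                ((σ x : K) : W.divisionField p)) → τ • P = a • P →
              ∀ (I J : (Ideal (𝓞 K))⁰),
                (J : Ideal (𝓞 K)) = (I : Ideal (𝓞 K)).map (AmbiguousClass.intAut σ : 𝓞 K →+* 𝓞 K) →
                μ (Additive.ofMul (ClassGroup.mk0 J)) = a • μ (Additive.ofMul (ClassGroup.mk0 I))) →
          μ = 0) :
    QuadraticBranchPlusEtaMainConjectureAt V p :=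
  EtaFineRoad.quadraticBranchPlusEtaMainConjectureAt_of_span_eq_span_X_of_conjA W p h22 h41 h6273 V C hp5 hC hgood hap
    hinf hX (conjA_partner_of_eigenHom p V W C hp5 hC hgood hap hns hP)

/-- **Rank-`0` shape: (C1⁺_η)(V) from the eigen datum, the analytic `μ`, `L(W,1) ≠ 0` and the lower bound `L₀(W,p)`** — door L2 fed to
`EtaFineRoad.quadraticBranchPlusEtaMainConjectureAt_of_conjA_of_analyticMu_of_missingLowerBoundAt` (census: the non-CM L2 row 313200ek1, `r_an(W) = 0`).
Named facts `hPT hmod hGZK h22 h41 hKO h6273`. CONDITIONAL; nothing booked. [cite: Kobayashi2003, §4 Even main conjecture and Thm. 4.1 (p. 8), Thm. 7.3 i) (p. 13)]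
[cite: CoatesSujatha2005, §3 statement (A)] [cite: Miller2011LMS, Def. 1.1] -/
theorem quadraticBranchPlusEtaMainConjectureAt_of_eigenHom_of_analyticMu_of_missingLowerBoundAt
    (hPT : poitouTate_selmerStructure_duality_real ℚ) (hmod : hasEntireLFunction_rat)
    (hGZK : rank_eq_analyticRank_of_analyticRank_le_one)
    (h22 : Kobayashi2003.thm22_etaSignedSelmerDual_finite_torsion)
    (h41 : Kobayashi2003.thm41_plusEtaCharIdeal_dvd)
    (hKO : KitajimaOtsuki2018.mainThm13_etaSignedSelmerDual_noFiniteSubmodule)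
    (h6273 : Kobayashi2003.thm62_63_73_etaColemanPoitouTate)
    [NeZero p] (hp5 : 5 ≤ p) (hC : C • W.quadraticTwist ((-1) ^ (p / 2) * p) = V)
    (hgood : V.HasGoodReductionAtPrime p) (hap : V.frobeniusTrace p = 0)
    (hns : ¬ ∀ m : ℕ, V.HasSurjectiveModNGaloisRep (p ^ m : ℕ))
    (hP : haveI : NumberField (W.divisionField p) := NumberField.mk
      ∃ P : geomTorsion W (p : ℤ), P ≠ 0 ∧
        ∀ K : IntermediateField ℚ (W.divisionField p),
          K = IntermediateField.fixedField
            ((MulAction.stabilizer (absoluteGaloisGroup ℚ) P).map (absRestrictNormalHom (W.divisionField p))) →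
        ∀ μ : Additive (ClassGroup (𝓞 K)) →+ ZMod p,
          (∀ (τ : absoluteGaloisGroup ℚ) (σ : K ≃ₐ[ℚ] K) (a : ℕ),
              (∀ x : K, absRestrictNormalHom (W.divisionField p) τ (x : W.divisionField p) =
                ((σ x : K) : W.divisionField p)) → τ • P = a • P →
              ∀ (I J : (Ideal (𝓞 K))⁰),
                (J : Ideal (𝓞 K)) = (I : Ideal (𝓞 K)).map (AmbiguousClass.intAut σ : 𝓞 K →+* 𝓞 K) →
                μ (Additive.ofMul (ClassGroup.mk0 J)) = a • μ (Additive.ofMul (ClassGroup.mk0 I))) →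
          μ = 0)
    (hμan : ∀ {N : ℕ} [NeZero N] {f : CuspForm (Gamma0 N) 2}, IsNewformOf V f →
      ∀ (ϖ : ℚ), (if Even (p / 2) then (ϖ : ℝ) * V.realPeriodRat = plusPeriod f
          else (ϖ : ℝ) * V.imaginaryPeriodRat = minusPeriod f) →
      ∀ (Lη : IwasawaAlgebra p), IsQuadraticBranchPlusLFunction f p ϖ Lη → HasUnitContent Lη)
    (hLW : W.entireLFunction 1 ≠ 0) (hlow : MissingLowerBoundAt W p) :
    QuadraticBranchPlusEtaMainConjectureAt V p :=
  EtaFineRoad.quadraticBranchPlusEtaMainConjectureAt_of_conjA_of_analyticMu_of_missingLowerBoundAt W p hPT hmod hGZK h22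
    h41 hKO h6273 V C hp5 hC hgood hap
    (conjA_partner_of_eigenHom p V W C hp5 hC hgood hap hns hP) hμan hLW hlow

/-- **CM rank-`0` shape: (C1⁺_η)(V) from the eigen datum, the analytic `μ` and `L(W,1) ≠ 0`** (the lower half is bsd.S28) — door L2 fed to
`EtaFineRoad.quadraticBranchPlusEtaMainConjectureAt_of_conjA_of_analyticMu_of_hasCM_rankZero` (census g21: the CM rank-0 L2 rows 176400ld1, 416025bc1,
114075bh1, 119025e1 and the anchor 10800cj1). Named facts `hPT hmod hGZK h22 h41 hKO hS28 h6273`. CONDITIONAL; nothing booked.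
[cite: Kobayashi2003, §4 Even main conjecture and Thm. 4.1 (p. 8)] [cite: BurungaleFlach2024, Thm 1.1 and Cor. 2] [cite: CoatesSujatha2005, §3 statement (A)] -/
theorem quadraticBranchPlusEtaMainConjectureAt_of_eigenHom_of_analyticMu_of_hasCM_rankZero
    (hPT : poitouTate_selmerStructure_duality_real ℚ) (hmod : hasEntireLFunction_rat)
    (hGZK : rank_eq_analyticRank_of_analyticRank_le_one)
    (h22 : Kobayashi2003.thm22_etaSignedSelmerDual_finite_torsion)
    (h41 : Kobayashi2003.thm41_plusEtaCharIdeal_dvd)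
    (hKO : KitajimaOtsuki2018.mainThm13_etaSignedSelmerDual_noFiniteSubmodule)
    (hS28 : bsdTriple_of_hasCM_of_L_one_ne_zero)
    (h6273 : Kobayashi2003.thm62_63_73_etaColemanPoitouTate)
    [NeZero p] (hp5 : 5 ≤ p) (hC : C • W.quadraticTwist ((-1) ^ (p / 2) * p) = V)
    (hgood : V.HasGoodReductionAtPrime p) (hap : V.frobeniusTrace p = 0)
    (hns : ¬ ∀ m : ℕ, V.HasSurjectiveModNGaloisRep (p ^ m : ℕ)) (hCM : V.HasCM)
    (hP : haveI : NumberField (W.divisionField p) := NumberField.mk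
      ∃ P : geomTorsion W (p : ℤ), P ≠ 0 ∧
        ∀ K : IntermediateField ℚ (W.divisionField p),
          K = IntermediateField.fixedField
            ((MulAction.stabilizer (absoluteGaloisGroup ℚ) P).map (absRestrictNormalHom (W.divisionField p))) →
        ∀ μ : Additive (ClassGroup (𝓞 K)) →+ ZMod p,
          (∀ (τ : absoluteGaloisGroup ℚ) (σ : K ≃ₐ[ℚ] K) (a : ℕ),
              (∀ x : K, absRestrictNormalHom (W.divisionField p) τ (x : W.divisionField p) =
                ((σ x : K) : W.divisionField p)) → τ • P = a • P →
              ∀ (I J : (Ideal (𝓞 K))⁰),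
                (J : Ideal (𝓞 K)) = (I : Ideal (𝓞 K)).map (AmbiguousClass.intAut σ : 𝓞 K →+* 𝓞 K) →
                μ (Additive.ofMul (ClassGroup.mk0 J)) = a • μ (Additive.ofMul (ClassGroup.mk0 I))) →
          μ = 0)
    (hμan : ∀ {N : ℕ} [NeZero N] {f : CuspForm (Gamma0 N) 2}, IsNewformOf V f →
      ∀ (ϖ : ℚ), (if Even (p / 2) then (ϖ : ℝ) * V.realPeriodRat = plusPeriod f
          else (ϖ : ℝ) * V.imaginaryPeriodRat = minusPeriod f) →
      ∀ (Lη : IwasawaAlgebra p), IsQuadraticBranchPlusLFunction f p ϖ Lη → HasUnitContent Lη)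
    (hLW : W.entireLFunction 1 ≠ 0) :
    QuadraticBranchPlusEtaMainConjectureAt V p :=
  EtaFineRoad.quadraticBranchPlusEtaMainConjectureAt_of_conjA_of_analyticMu_of_hasCM_rankZero W p hPT hmod hGZK h22 h41
    hKO hS28 h6273 V C hp5 hC hgood hap hCM
    (conjA_partner_of_eigenHom p V W C hp5 hC hgood hap hns hP) hμan hLW

end Upper

end Summit.BirchSwinnertonDyer.BirchSwinnertonDyer.Theorems.EtaConjADoorEigen

end
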